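import Literature.NumberTheory.Automorphic.AutomorphicRepsGLIrreducibleL2Adm
import Literature.NumberTheory.Automorphic.AutomorphicRepsGLAnalyticVectorsHolds
import Literature.NumberTheory.Automorphic.HarishChandraFinitenessGLCuspidal
import HarnessLib

/-!
# Realisation of irreducible spaces of cusp forms on `GL_n` in `L²_cusp`: the `K`-finite half of
# Harish-Chandra's correspondence, DISCHARGED

Topic `NumberTheory/Automorphic`; the Holds file of `AutomorphicRepsGLIrreducibleL2HC`, whose named
fact `AutomorphicRepsGL.cuspidal_closure_exists_mem_l2OfForms hcpt μ` (for an irreducible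
`(𝔤, K_∞) × GL_n(𝔸_K^∞)`-stable space `W` of `A_G`-invariant cusp forms on `GL_n(𝔸_K)`, every
non-zero closed `GL_n(𝔸_K)`-invariant subspace `Q ≤ Cl[W]` of `L²` contains a non-zero element
`[φ]`, `φ ∈ W`; Harish-Chandra 1953, Thm. 5) is proved here unconditionally:

* `AutomorphicRepsGL.cuspidal_closure_exists_mem_l2OfForms_holds`.

`AutomorphicRepsGLIrreducibleL2Adm` proved the fact from the admissibility of the `K_∞`-modules
`(W / ⊥)^U` of ALL cuspidal data (`cuspidal_closure_exists_mem_l2OfForms_of_isAdmissibleGK`), i.e.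
from the second clause of the named fact `automorphicRep_isAdmissible hcpt` (Borel–Jacquet 1979,
4.5), itself waiting on Harish-Chandra's finiteness theorem (Borel–Jacquet 4.3 (i)). For the data the
fact concerns — `W` irreducible, cuspidal, with `A_G`-INVARIANT elements — that admissibility is a
theorem of the tree: the cuspidal case of Harish-Chandra's finiteness theorem for `A_G`-invariant
cusp forms is `finiteDimensional_span_cuspForms_of_ideal` (`HarishChandraFinitenessGLCuspidal`,
Harish-Chandra 1968, Lemma 9 / Borel–Jacquet 4.3 (i) with 4.4, by compact operators on `L²_cusp`),
and Borel–Jacquet's deduction 4.3 (i) ⇒ 4.5 is carried out for a single datum by the lemmas of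
`LangAutomorphicFormsAdmissibleProofs` (§§2–7 there: the annihilator `J`, the stable `V` with
`W = V + W'`, averaging over the level, complete reducibility of the `K_∞`-action). Hence:

1. `finiteDimensional_span_cuspForms_of_ideal_gl` (§1): the cuspidal finiteness theorem spelled with
   the archimedean objects of the datum `AutomorphyDatum.gl n K hcpt` (definitional bridge, as
   `harishChandra_finiteness.apply_gl`).
2. `exists_finiteDimensional_forall_intertwiningMap_mem_cuspidal` (§2): for `V` a space of
   `A_G`-invariant cusp forms killed by an ideal `J ≤ Z(𝔤)` of finite codimension and `U` a level,
   all `K_∞`-maps `τ → V ∩ 𝒜^U` take values in one finite-dimensional space (the step "`A(U, J)` of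
   type `τ` is finite-dimensional" of Borel–Jacquet 4.5, copy of
   `exists_finiteDimensional_forall_intertwiningMap_mem_gl` with the cuspidal theorem as input).
3. `CuspidalAutomorphicRepData.isAdmissibleGK_kRepFixed_of_center'` (§3): for a cuspidal datum
   `π = W / W'` with `A_G`-invariant elements and a level `U`, the `K_∞`-module `(W / W')^U` has
   finite `K_∞`-multiplicities (assembly as in
   `AutomorphicRepData.isAdmissibleGK_kRepFixed_gl_of_harishChandra_finiteness`).
4. `AutomorphicRepsGL.cuspidal_closure_exists_mem_l2OfForms_holds` (§4): the proof of
   `cuspidal_closure_exists_mem_l2OfForms_of_isAdmissibleGK` (orthogonal projection onto `Q`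
   commuting with `R`, a `K_∞`-finite `U`-fixed `x = P_Q [g] ≠ 0` in `Q ∩ Cl[W]`, and
   `mem_l2OfForms_of_mem_closure_of_kFinite` — Harish-Chandra's `Cl(V') ∩ U' = V'`) with the
   admissibility of `[W] ∩ Fix(U) ↪ (W / ⊥)^U` now supplied by §3.

Corollaries (§5, one-liners over the discharged `cuspidal_bounded_holds` of `CuspFormsBoundedHC` and
`cuspidal_analyticAt_rightRegular_of_bounded` of `AutomorphicRepsGLAnalyticVectorsHolds`): the
discharges `AutomorphicRepsGL.cuspidal_closure_irreducible_holds` (Harish-Chandra's Thm. 5 for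
irreducible spaces of `A_G`-invariant cusp forms: a closed invariant `Q ≤ Cl[W]` is `⊥` or contains
`[W]`; named fact of `AutomorphicRepsGLIrreducibleL2Proofs`) and
`AutomorphicRepsGL.exists_le_formsOfL2_of_W'_eq_bot_holds` (an irreducible stable space of
`A_G`-invariant cusp forms lies in `V_Π` for an irreducible closed invariant `Π ≤ L²_cusp`; named
fact of `AutomorphicRepsGLIrreducibleL2`, Borel–Jacquet 1979, 4.6).

Everything here is proved: theorems only, no definition, no named fact, no `sorry`.

## References

* Harish-Chandra, *Representations of a semisimple Lie group on a Banach space. I*, Trans. AMS 75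
  (1953), 185–243 (held, `paper:doi-10-1090-s0002-9947-1953-0056610-2`): Thm. 5 and its proof
  (printed pp. 228–229) [HarishChandraTAMS1953].
* A. Borel, H. Jacquet, *Automorphic forms and automorphic representations*, Proc. Sympos. Pure
  Math. 33 (Corvallis 1977), Part 1 (1979), 189–202, 4.3 (i), 4.4, 4.5, 4.6
  [BorelJacquetCorvallis1979].
* Harish-Chandra, *Automorphic forms on semisimple Lie groups*, LNM 62 (1968), §2, Lemma 9, Thm. 1.
* M. Libine, *Introduction to Representations of Real Semisimple Lie Groups*, arXiv:1212.2578,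
  Lemma 74, Cor. 75 [Libine2012].
* J. R. Getz, H. Hahn, *An Introduction to Automorphic Representations*, GTM 300 (2024), Thm. 6.1,
  Thm. 9.1.1, Lemma 9.3.2 [GetzHahn2024].
-/

open scoped MatrixGroups Matrix ContDiff Classical InnerProductSpace
open NumberField NumberField.mixedEmbedding IsDedekindDomain
open _root_.MeasureTheory

noncomputable section

namespace Literature.NumberTheory.Automorphic

/-! ### 1. The cuspidal finiteness theorem spelled with the datum's archimedean objects -/

section Finiteness

variable {n : ℕ} {K : Type} [Field K] [NumberField K] {hcpt : isCompact_glFiniteIntegralLevel n K}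

/-- **Harish-Chandra's finiteness theorem for `A_G`-invariant cusp forms on `GL_n(𝔸_K)`** (the
theorem `finiteDimensional_span_cuspForms_of_ideal` of `HarishChandraFinitenessGLCuspidal`) spelled
with the archimedean objects of the datum `AutomorphyDatum.gl n K hcpt`
(`(AutomorphyDatum.gl n K hcpt).arch = archGroupGL n K` and
`(AutomorphyDatum.gl n K hcpt).arch.maximalCompact = Kinf n K` definitionally) and with the
finiteness instances as explicit hypotheses: the `A_G`-invariant cusp forms of level `U`, killed by
an ideal `J ≤ Z(𝔤)` of finite codimension and with `K_∞`-slices in a finite-dimensional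
right-`K_∞`-stable `M`, span a finite-dimensional space. Harish-Chandra 1968, §2, Lemma 9;
Borel–Jacquet 1979, 4.3 (i) with 4.4. [cite: BorelJacquetCorvallis1979, 4.3 (i) and 4.4] -/
theorem finiteDimensional_span_cuspForms_of_ideal_gl
    {U : Subgroup (GL (Fin n) (AdeleRing (𝓞 K) K))} (hU : U ∈ finiteLevelsGL n K)
    (J : Ideal (centerU (AutomorphyDatum.gl n K hcpt).arch))
    (hJ : FiniteDimensional ℝ (centerU (AutomorphyDatum.gl n K hcpt).arch ⧸ J))
    (M : Submodule ℂ ((AutomorphyDatum.gl n K hcpt).arch.maximalCompact → ℂ)) (hMfin : FiniteDimensional ℂ M)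
    (hM : ∀ k₀ : (AutomorphyDatum.gl n K hcpt).arch.maximalCompact, ∀ f ∈ M, (fun k ↦ f (k * k₀)) ∈ M) :
    FiniteDimensional ℂ (Submodule.span ℂ
      {φ : (AdelicGroupData.gl n K).Adelic → ℂ |
        IsCuspFormGL n K hcpt φ ∧
        (∀ z ∈ (AdelicGroupData.gl n K).center', ∀ g, φ (z * g) = φ g) ∧
        IsRightInvariantUnder U φ ∧
        (∀ (p : FreeAlgebra ℝ (AutomorphyDatum.gl n K hcpt).arch.lie) (hp : IsCentralWord p),
          (⟨freeToEnveloping (AutomorphyDatum.gl n K hcpt).arch p, hp⟩ : centerU (AutomorphyDatum.gl n K hcpt).arch) ∈ J →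
            applyFree (AutomorphyDatum.gl n K hcpt).ofArch p φ = 0) ∧
        ∀ g : (AdelicGroupData.gl n K).Adelic,
          (fun k : (AutomorphyDatum.gl n K hcpt).arch.maximalCompact ↦ φ (g * (AutomorphyDatum.gl n K hcpt).ofK k)) ∈ M}) :=
  @finiteDimensional_span_cuspForms_of_ideal n K _ _ hcpt U hU J hJ M hMfin hM

/-! ### 2. The `K_∞`-maps into `V ∩ 𝒜^U` for `V` a space of `A_G`-invariant cusp forms killed by `J` -/

/-- **All `K_∞`-maps `τ → S = V ∩ 𝒜^U` take values in one finite-dimensional space**, for `V` a space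
of `A_G`-invariant cusp forms killed by an ideal `J ≤ Z(𝔤)` of finite codimension: the values of such
a map `f'` are `A_G`-invariant cusp forms of level `U`, killed by `J`, all of whose `K_∞`-slices
`k ↦ (f' t)(g k) = (f' (τ(k) t))(g)` are matrix coefficients of `τ` (`coeffSpace`) — a
finite-dimensional space by the cuspidal case of Harish-Chandra's finiteness theorem
(`finiteDimensional_span_cuspForms_of_ideal_gl`). The step "`A(U, J)` of `K_∞`-type `τ` is
finite-dimensional" of Borel–Jacquet 1979, 4.5, for cusp forms. [cite: BorelJacquetCorvallis1979, 4.5] -/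
theorem exists_finiteDimensional_forall_intertwiningMap_mem_cuspidal
    {U : Subgroup (GL (Fin n) (AdeleRing (𝓞 K) K))} (hU : U ∈ finiteLevelsGL n K)
    {V : Submodule ℂ ((AdelicGroupData.gl n K).Adelic → ℂ)} (hVc : V ≤ cuspFormsGL n K hcpt)
    (hVZ : ∀ ψ ∈ V, ∀ z ∈ (AdelicGroupData.gl n K).center', ∀ g, ψ (z * g) = ψ g)
    (J : Ideal (centerU (AutomorphyDatum.gl n K hcpt).arch)) (hJfin : FiniteDimensional ℝ (centerU (AutomorphyDatum.gl n K hcpt).arch ⧸ J))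
    (hVJ : ∀ ψ ∈ V, ∀ (p : FreeAlgebra ℝ (AutomorphyDatum.gl n K hcpt).arch.lie) (hp : IsCentralWord p),
      (⟨freeToEnveloping (AutomorphyDatum.gl n K hcpt).arch p, hp⟩ : centerU (AutomorphyDatum.gl n K hcpt).arch) ∈ J → applyFree (AutomorphyDatum.gl n K hcpt).ofArch p ψ = 0)
    (ρ : Representation ℂ (AutomorphyDatum.gl n K hcpt).arch.maximalCompact ↥(V ⊓ (rightTranslation (AdelicGroupData.gl n K)).fixedPoints U))
    (hρ : ∀ (k : (AutomorphyDatum.gl n K hcpt).arch.maximalCompact) (v : ↥(V ⊓ (rightTranslation (AdelicGroupData.gl n K)).fixedPoints U)),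
      ((ρ k v : ↥(V ⊓ (rightTranslation (AdelicGroupData.gl n K)).fixedPoints U)) : (AdelicGroupData.gl n K).Adelic → ℂ) =
        rightTranslation (AdelicGroupData.gl n K) ((AutomorphyDatum.gl n K hcpt).ofK k) v)
    {T : Type} [AddCommGroup T] [Module ℂ T] [FiniteDimensional ℂ T]
    (τ : Representation ℂ (AutomorphyDatum.gl n K hcpt).arch.maximalCompact T) :
    ∃ A : Submodule ℂ ↥(V ⊓ (rightTranslation (AdelicGroupData.gl n K)).fixedPoints U), FiniteDimensional ℂ A ∧
      ∀ f' : τ.IntertwiningMap ρ, ∀ t, f' t ∈ A := by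
  -- the space of matrix coefficients of `τ`
  have hM : ∀ k₀ : (AutomorphyDatum.gl n K hcpt).arch.maximalCompact, ∀ f ∈ coeffSpace (fun k ↦ (τ k : T →ₗ[ℂ] T)),
      (fun k ↦ f (k * k₀)) ∈ coeffSpace (fun k ↦ (τ k : T →ₗ[ℂ] T)) :=
    fun k₀ f hf ↦ comp_mul_right_mem_coeffSpace (fun k k' ↦ map_mul τ k k') k₀ hf
  have hfin := finiteDimensional_span_cuspForms_of_ideal_gl (hcpt := hcpt) hU J hJfin
    (coeffSpace (fun k ↦ (τ k : T →ₗ[ℂ] T))) (finiteDimensional_coeffSpace _) hM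
  -- name the span bounded by the finiteness theorem (kept opaque, with its defining equation)
  have hAex : ∃ A : Submodule ℂ ((AdelicGroupData.gl n K).Adelic → ℂ), A = Submodule.span ℂ
      {φ : (AdelicGroupData.gl n K).Adelic → ℂ |
        IsCuspFormGL n K hcpt φ ∧
        (∀ z ∈ (AdelicGroupData.gl n K).center', ∀ g, φ (z * g) = φ g) ∧
        IsRightInvariantUnder U φ ∧
        (∀ (p : FreeAlgebra ℝ (AutomorphyDatum.gl n K hcpt).arch.lie) (hp : IsCentralWord p),
          (⟨freeToEnveloping (AutomorphyDatum.gl n K hcpt).arch p, hp⟩ : centerU (AutomorphyDatum.gl n K hcpt).arch) ∈ J →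
            applyFree (AutomorphyDatum.gl n K hcpt).ofArch p φ = 0) ∧
        ∀ g : (AdelicGroupData.gl n K).Adelic, (fun k : (AutomorphyDatum.gl n K hcpt).arch.maximalCompact ↦ φ (g * (AutomorphyDatum.gl n K hcpt).ofK k)) ∈
          coeffSpace (fun k ↦ (τ k : T →ₗ[ℂ] T))} := ⟨_, rfl⟩
  refine hAex.elim fun A hA ↦ ?_
  have hAfin : FiniteDimensional ℂ A := by
    rw [hA]
    exact hfin
  refine ⟨A.comap (V ⊓ (rightTranslation (AdelicGroupData.gl n K)).fixedPoints U).subtype, ?_, fun f' t ↦ ?_⟩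
  · -- finite-dimensional: it embeds in `A`
    haveI := hAfin
    exact FiniteDimensional.of_injective
      (((V ⊓ (rightTranslation (AdelicGroupData.gl n K)).fixedPoints U).subtype).restrict
        (p := A.comap (V ⊓ (rightTranslation (AdelicGroupData.gl n K)).fixedPoints U).subtype) (q := A) fun x hx ↦ hx)
      fun x y hxy ↦ Subtype.ext (Subtype.ext (congrArg (fun z : A ↦ (z : (AdelicGroupData.gl n K).Adelic → ℂ)) hxy))
  · -- the values of a `K_∞`-map lie in it
    rw [Submodule.mem_comap, hA]
    refine Submodule.subset_span ⟨isCuspFormGL_of_mem_cuspFormsGL' (hVc (f' t).2.1),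
      hVZ _ (f' t).2.1,
      fun u hu g ↦ congrFun ((Representation.mem_fixedPoints _ U _).1 (f' t).2.2 u hu) g,
      fun p hp hpJ ↦ hVJ _ (f' t).2.1 p hp hpJ, fun g ↦ ?_⟩
    have hslice : (fun k : (AutomorphyDatum.gl n K hcpt).arch.maximalCompact ↦
        ((f' t : ↥(V ⊓ (rightTranslation (AdelicGroupData.gl n K)).fixedPoints U)) : (AdelicGroupData.gl n K).Adelic → ℂ) (g * (AutomorphyDatum.gl n K hcpt).ofK k)) =
        fun k ↦ ((LinearMap.proj g : ((AdelicGroupData.gl n K).Adelic → ℂ) →ₗ[ℂ] ℂ) ∘ₗ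
          (V ⊓ (rightTranslation (AdelicGroupData.gl n K)).fixedPoints U).subtype ∘ₗ f'.toLinearMap) (τ k t) := by
      funext k
      change _ = ((f' (τ k t) : ↥(V ⊓ (rightTranslation (AdelicGroupData.gl n K)).fixedPoints U)) : (AdelicGroupData.gl n K).Adelic → ℂ) g
      rw [Representation.IntertwiningMap.isIntertwining τ ρ f' k t, hρ]
      rfl
    exact (congrArg (· ∈ coeffSpace (fun k ↦ (τ k : T →ₗ[ℂ] T))) hslice).mpr
      (coeff_mem_coeffSpace _ _ t)

/-! ### 3. Cuspidal automorphic representations with `A_G`-invariant elements are admissible -/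

/-- **Borel–Jacquet 4.5 for cuspidal representations of `GL_n(𝔸_K)` with `A_G`-invariant elements,
unconditionally.** For a cuspidal automorphic representation datum `π = W / W'` (`W ≤ 𝒜₀`) whose
elements are invariant under `A_G` and a level `U`, the `K_∞`-module `(W / W')^U` has finite
`K_∞`-multiplicities. Proof (Borel–Jacquet 4.5–4.6): by
`AutomorphicRepData.exists_annihilated_stable_gl`, `W = V + W'` with `V` stable and killed by an
ideal `J ≤ Z(𝔤)` of finite codimension; `(W / W')^U` is a `K_∞`-quotient of `S = V ∩ 𝒜^U`
(`exists_surjective_intertwiningMap_kRepFixed_gl`), whose `K_∞`-action is completely reducible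
(`isSemisimpleRepresentation_kinf_gl`), so `Hom_{K_∞}(τ, (W / W')^U)` is bounded by the
finite-dimensional space of values of the `K_∞`-maps `τ → S`
(`exists_finiteDimensional_forall_intertwiningMap_mem_cuspidal`, the cuspidal case of
Harish-Chandra's finiteness theorem; `Representation.finiteDimensional_intertwiningMap_of_surjective`).
[cite: BorelJacquetCorvallis1979, 4.5] -/
theorem CuspidalAutomorphicRepData.isAdmissibleGK_kRepFixed_of_center'
    (π : CuspidalAutomorphicRepData n K hcpt)
    (hπ : ∀ φ ∈ π.1.W, ∀ z ∈ (AdelicGroupData.gl n K).center', ∀ g, φ (z * g) = φ g)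
    {U : Subgroup (GL (Fin n) (AdeleRing (𝓞 K) K))} (hU : U ∈ finiteLevelsGL n K) :
    IsAdmissibleGK (π.1.kRepFixed (U.subgroupOf (AutomorphyDatum.gl n K hcpt).finiteAdelic)) := by
  intro T _ _ _ τ _
  refine π.1.exists_annihilated_stable_gl.elim fun J h ↦ h.elim fun V h ↦ ?_
  have hJfin := h.1
  have hVW := h.2.1
  have hVst := h.2.2.1
  have hVJ := h.2.2.2.1
  have hWle := h.2.2.2.2
  have hVA : V ≤ automorphicForms (AutomorphyDatum.gl n K hcpt) := hVW.trans π.1.stable.le_automorphicForms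
  have hVc : V ≤ cuspFormsGL n K hcpt := hVW.trans π.2
  have hVZ : ∀ ψ ∈ V, ∀ z ∈ (AdelicGroupData.gl n K).center', ∀ g, ψ (z * g) = ψ g :=
    fun ψ hψ ↦ hπ ψ (hVW hψ)
  refine (π.1.exists_surjective_intertwiningMap_kRepFixed_gl hU hVW hVst hWle).elim fun hS h ↦
    h.elim fun Φ hΦ ↦ ?_
  have hρ : ∀ (k : (AutomorphyDatum.gl n K hcpt).arch.maximalCompact) (v : ↥(V ⊓ (rightTranslation (AdelicGroupData.gl n K)).fixedPoints U)),
      ((Representation.subrepresentation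
          (MonoidHom.comp (rightTranslation (AdelicGroupData.gl n K)) (AutomorphyDatum.gl n K hcpt).ofK :
            Representation ℂ (AutomorphyDatum.gl n K hcpt).arch.maximalCompact ((AdelicGroupData.gl n K).Adelic → ℂ))
          (V ⊓ (rightTranslation (AdelicGroupData.gl n K)).fixedPoints U) hS k v :
            ↥(V ⊓ (rightTranslation (AdelicGroupData.gl n K)).fixedPoints U)) : (AdelicGroupData.gl n K).Adelic → ℂ) =
        rightTranslation (AdelicGroupData.gl n K) ((AutomorphyDatum.gl n K hcpt).ofK k) v :=
    fun k v ↦ rfl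
  haveI := isSemisimpleRepresentation_kinf_gl (V ⊓ (rightTranslation (AdelicGroupData.gl n K)).fixedPoints U)
    (inf_le_left.trans hVA) _ hρ
  refine (exists_finiteDimensional_forall_intertwiningMap_mem_cuspidal hU hVc hVZ J hJfin hVJ _ hρ τ).elim
    fun A h ↦ ?_
  haveI := h.1
  exact Representation.finiteDimensional_intertwiningMap_of_surjective Φ hΦ A h.2

end Finiteness

/-! ### 4. The discharge -/

section Main

variable {n : ℕ} {K : Type} [Field K] [NumberField K]
  {hcpt : isCompact_glFiniteIntegralLevel n K}
  {μ : Measure (AdelicGroupData.gl n K).automorphicQuotient}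
  [(AdelicGroupData.gl n K).IsAutomorphicMeasure μ]

/-- **Non-zero closed invariant subspaces of `Cl[W]` meet `[W]`** — the named fact
`AutomorphicRepsGL.cuspidal_closure_exists_mem_l2OfForms hcpt μ` of `AutomorphicRepsGLIrreducibleL2HC`
(the `K`-finite half of Harish-Chandra's Thm. 5 for irreducible spaces of `A_G`-invariant cusp forms
on `GL_n`), DISCHARGED. Let `π = W / ⊥` be cuspidal with `A_G`-invariant elements and
`⊥ ≠ Q ≤ Cl[W]` closed and `GL_n(𝔸_K)`-invariant. The orthogonal projection `P_Q` commutes with the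
unitary `R(g)` (`IsUnitary.starProjection_map_eq`); some `w = [g] ∈ [W]` has `x = P_Q w ≠ 0`
(otherwise `Q ⊆ Cl[W] ⊆ Qᗮ`); `x ∈ Q ⊆ Cl[W]` is fixed by the level `U = {1} × U₀` of `invQuot g`
and is `K_∞`-finite (its orbit span is `P_Q` of that of `w`); `[W] ∩ Fix(U)` embeds
`K_∞`-equivariantly into `(W / ⊥)^U` (`exists_injective_intertwiningMap_kRepFixed`), which is
admissible by the cuspidal case of Harish-Chandra's finiteness theorem
(`CuspidalAutomorphicRepData.isAdmissibleGK_kRepFixed_of_center'`), so `[W] ∩ Fix(U)` is admissible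
(`isAdmissibleGK_of_injective`) and `x ∈ [W]` by `mem_l2OfForms_of_mem_closure_of_kFinite`
(Harish-Chandra's `Cl(V') ∩ U' = V'`: "since `dim (V'_𝔇) ≤ dim ℌ_𝔇 < ∞`, `V_𝔇 = V'_𝔇`").
Harish-Chandra 1953, Thm. 5 (proof, p. 229); Libine 2012, Lemma 74; admissibility by
Borel–Jacquet 1979, 4.3 (i), 4.5. [cite: HarishChandraTAMS1953, Thm. 5 (pp. 228–229)] -/
theorem AutomorphicRepsGL.cuspidal_closure_exists_mem_l2OfForms_holds :
    AutomorphicRepsGL.cuspidal_closure_exists_mem_l2OfForms hcpt μ := by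
  intro π hbot hπ Q hQ hQ0
  -- Step 0: notation
  have hW := π.1.stable
  have hWc : ∀ ψ ∈ π.1.W, Continuous ψ := fun ψ hψ ↦
    continuous_of_mem_automorphicForms_gl (hW.le_automorphicForms hψ)
  have hWk : ∀ ψ ∈ π.1.W, IsKFinite (AutomorphyDatum.gl n K hcpt).ofArch ψ := fun ψ hψ ↦
    hW.isKFinite hψ
  have hR : ((AdelicGroupData.gl n K).rightRegular μ).IsUnitary :=
    (AdelicGroupData.gl n K).isUnitary_rightRegular μ
  -- Step 1: the orthogonal projection onto `Q` commutes with `R`, and does not kill `[W]`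
  have hQK : ∀ g, ∀ v ∈ Q.toSubmodule, (AdelicGroupData.gl n K).rightRegular μ g v ∈ Q.toSubmodule :=
    fun g v hv ↦ Q.apply_mem g hv
  have hPR : ∀ g v, Q.toSubmodule.starProjection ((AdelicGroupData.gl n K).rightRegular μ g v) =
      (AdelicGroupData.gl n K).rightRegular μ g (Q.toSubmodule.starProjection v) := fun g v ↦
    hR.starProjection_map_eq hQK g v
  have hex : ∃ w ∈ l2OfForms (AdelicGroupData.gl n K) μ π.1.W, Q.toSubmodule.starProjection w ≠ 0 := by
    by_contra hcon
    push Not at hcon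
    have hLQ : l2OfForms (AdelicGroupData.gl n K) μ π.1.W ≤ Q.toSubmoduleᗮ := fun w hw ↦
      (Submodule.starProjection_apply_eq_zero_iff Q.toSubmodule).mp (hcon w hw)
    have hClQ : (l2OfForms (AdelicGroupData.gl n K) μ π.1.W).topologicalClosure ≤ Q.toSubmoduleᗮ :=
      Submodule.topologicalClosure_minimal _ hLQ (Submodule.isClosed_orthogonal _)
    apply hQ0
    refine ContRepresentation.ClosedSubrep.ext fun v ↦ ?_
    rw [ContRepresentation.ClosedSubrep.mem_bot]
    constructor
    · intro hv
      have hv' : v ∈ Q.toSubmodule ⊓ Q.toSubmoduleᗮ := ⟨hv, hClQ (hQ hv)⟩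
      rwa [Submodule.inf_orthogonal_eq_bot, Submodule.mem_bot] at hv'
    · rintro rfl
      exact Q.toSubmodule.zero_mem
  obtain ⟨w, hwL, hw0⟩ := hex
  obtain ⟨g, hg, rfl, hgW⟩ := hwL
  have hwL : hg.toLp g ∈ l2OfForms (AdelicGroupData.gl n K) μ π.1.W := toLp_mem_l2OfForms hg hgW
  set x : (AdelicGroupData.gl n K).L2 μ := Q.toSubmodule.starProjection (hg.toLp g) with hx_def
  have hxQ : x ∈ Q.toSubmodule := Q.toSubmodule.starProjection_apply_mem _
  have hxcl : x ∈ (l2OfForms (AdelicGroupData.gl n K) μ π.1.W).topologicalClosure := hQ hxQ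
  -- Step 2: a compact open level `U = {1} × U₀` fixing `invQuot g`; `w` and `x` are `U`-fixed
  obtain ⟨U₁, hU₁o, hU₁fix⟩ :=
    exists_isOpen_forall_rightTranslation_ofFinite_eq (hW.le_automorphicForms hgW)
  set U₀ : Subgroup (GL (Fin n) (FiniteAdeleRing (𝓞 K) K)) := U₁ ⊓ glFiniteIntegralLevel n K
    with hU₀_def
  have hU₀o : IsOpen (U₀ : Set (GL (Fin n) (FiniteAdeleRing (𝓞 K) K))) := by
    rw [hU₀_def, Subgroup.coe_inf]
    exact hU₁o.inter (isOpen_glFiniteIntegralLevel n K)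
  have hU₀c : IsCompact (U₀ : Set (GL (Fin n) (FiniteAdeleRing (𝓞 K) K))) := by
    rw [hU₀_def, Subgroup.coe_inf]
    exact IsCompact.inter_left hcpt (U₁.isClosed_of_isOpen hU₁o)
  set U : Subgroup (AdelicGroupData.gl n K).Adelic := U₀.map (GLn.ofFinite n K) with hU_def
  have hU : U ∈ finiteLevelsGL n K := ⟨U₀, hU₀o, hU₀c, rfl⟩
  have hUfin : U ≤ (AutomorphyDatum.gl n K hcpt).finiteAdelic :=
    le_range_ofFinite_of_mem_finiteLevelsGL hU
  have hUφ : ∀ u ∈ U, rightTranslation (AdelicGroupData.gl n K) u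
      (invQuot (AdelicGroupData.gl n K) g) = invQuot (AdelicGroupData.gl n K) g := by
    rintro _ ⟨u₀, hu₀, rfl⟩
    exact hU₁fix u₀ hu₀.1
  have hFixU : ∀ v ∈ (((AdelicGroupData.gl n K).rightRegular μ).restrict
      (U).subtype).invariants, ∀ u ∈ U,
        (AdelicGroupData.gl n K).rightRegular μ u v = v := fun v hv u hu ↦
    (ContRepresentation.mem_invariants v).mp hv ⟨u, hu⟩
  have hwFix : hg.toLp g ∈ (((AdelicGroupData.gl n K).rightRegular μ).restrict
      (U).subtype).invariants :=
    (ContRepresentation.mem_invariants _).mpr fun u ↦ rightRegular_toLp_eq_self hg (hUφ _ u.2)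
  have hxFix : x ∈ (((AdelicGroupData.gl n K).rightRegular μ).restrict
      (U).subtype).invariants := by
    refine (ContRepresentation.mem_invariants x).mpr fun u ↦ ?_
    change (AdelicGroupData.gl n K).rightRegular μ (u : (AdelicGroupData.gl n K).Adelic) x = x
    rw [hx_def, ← hPR, hFixU _ hwFix _ u.2]
  -- Step 3: `x` is `K_∞`-finite: its orbit span is the image under `P_Q` of that of `w`
  haveI hFw : FiniteDimensional ℂ ((kinfRegular hcpt μ).orbitSpan (hg.toLp g)) :=
    finiteDimensional_orbitSpan_of_mem_l2OfForms hWc hWk hwL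
  have hFle : (kinfRegular hcpt μ).orbitSpan x ≤ ((kinfRegular hcpt μ).orbitSpan (hg.toLp g)).map
      (Q.toSubmodule.starProjection : (AdelicGroupData.gl n K).L2 μ →ₗ[ℂ] (AdelicGroupData.gl n K).L2 μ) := by
    refine (kinfRegular hcpt μ).orbitSpan_le (fun k v hv ↦ ?_)
      ⟨hg.toLp g, (kinfRegular hcpt μ).mem_orbitSpan_self _, rfl⟩
    obtain ⟨v', hv', rfl⟩ := hv
    exact ⟨kinfRegular hcpt μ k v', (kinfRegular hcpt μ).apply_mem_orbitSpan_of_mem k hv', hPR _ v'⟩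
  have hxK : FiniteDimensional ℂ ((kinfRegular hcpt μ).orbitSpan x) :=
    Submodule.finiteDimensional_of_le hFle
  -- Step 4: `S = [W] ∩ Fix(U)` embeds into `(W / ⊥)^U`, admissible by the cuspidal finiteness
  -- theorem for the `A_G`-invariant `W`, and the machine applies
  have hSK : ∀ k, ∀ v ∈ l2OfForms (AdelicGroupData.gl n K) μ π.1.W ⊓
      (((AdelicGroupData.gl n K).rightRegular μ).restrict (U).subtype).invariants,
      kinfRegular hcpt μ k v ∈ l2OfForms (AdelicGroupData.gl n K) μ π.1.W ⊓
        (((AdelicGroupData.gl n K).rightRegular μ).restrict (U).subtype).invariants :=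
    fun k v hv ↦ ⟨rightRegular_apply_mem_l2OfForms (hW.k_stable k) hv.1,
      kinfRegular_apply_mem_invariants hUfin k hv.2⟩
  obtain ⟨T, hT⟩ := exists_injective_intertwiningMap_kRepFixed (μ := μ) π.1 hbot _ hFixU hSK
  have hadmS : IsAdmissibleGK ((kinfRegular hcpt μ).subRep _ hSK) :=
    isAdmissibleGK_of_injective T hT (π.isAdmissibleGK_kRepFixed_of_center' hπ hU)
  exact ⟨x, mem_l2OfForms_of_mem_closure_of_kFinite hW hU₀c hSK hadmS hxcl hxFix hxK, hw0, hxQ⟩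

/-! ### 5. Corollaries: Harish-Chandra's correspondence and the realisation in `L²_cusp` -/

/-- **Harish-Chandra's Thm. 5 for irreducible spaces of `A_G`-invariant cusp forms on `GL_n`,
unconditionally**: the named fact `AutomorphicRepsGL.cuspidal_closure_irreducible hcpt μ` of
`AutomorphicRepsGLIrreducibleL2Proofs` — for an irreducible stable `W` of `A_G`-invariant cusp forms,
a closed `GL_n(𝔸_K)`-invariant subspace `Q ≤ Cl[W]` of `L²` is `⊥` or contains `[W]` — follows from
boundedness (`cuspidal_bounded_holds`, `CuspFormsBoundedHC`) and the discharge above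
(`cuspidal_closure_irreducible_of` of `AutomorphicRepsGLIrreducibleL2HC`). Harish-Chandra 1953, Thm. 5;
Libine 2012, Cor. 75. [cite: HarishChandraTAMS1953, Thm. 5 (pp. 228–229)] -/
theorem AutomorphicRepsGL.cuspidal_closure_irreducible_holds :
    AutomorphicRepsGL.cuspidal_closure_irreducible hcpt μ :=
  AutomorphicRepsGL.cuspidal_closure_irreducible_of AutomorphicRepsGL.cuspidal_bounded_holds
    AutomorphicRepsGL.cuspidal_closure_exists_mem_l2OfForms_holds

/-- **An irreducible stable space of `A_G`-invariant cusp forms on `GL_n(𝔸_K)` lies in some `V_Π`,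
`Π ≤ L²_cusp` irreducible closed invariant, unconditionally**: the named fact
`AutomorphicRepsGL.exists_le_formsOfL2_of_W'_eq_bot hcpt μ` of `AutomorphicRepsGLIrreducibleL2`
follows from boundedness (`cuspidal_bounded_holds`), the analyticity of the `L²`-orbits it implies
(`exists_le_formsOfL2_of_W'_eq_bot_of_bounded_of_exists_mem`, `AutomorphicRepsGLAnalyticVectorsHolds`)
and the discharge above. Borel–Jacquet 1979, 4.6; Harish-Chandra 1953, Cor. to Thm. 2 and Thm. 5.
[cite: BorelJacquetCorvallis1979, 4.6] -/
theorem AutomorphicRepsGL.exists_le_formsOfL2_of_W'_eq_bot_holds :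
    AutomorphicRepsGL.exists_le_formsOfL2_of_W'_eq_bot hcpt μ :=
  AutomorphicRepsGL.exists_le_formsOfL2_of_W'_eq_bot_of_bounded_of_exists_mem
    AutomorphicRepsGL.cuspidal_bounded_holds
    AutomorphicRepsGL.cuspidal_closure_exists_mem_l2OfForms_holds

end Main

end Literature.NumberTheory.Automorphic
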